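/- Copyright: the b2b-balaban cell (near-miss cell 7), T⁴-continuum fan-out, ROUND-2 swarm `t4-ne7b-formalise-*`
(leaf 08), row NE7b (node U5c COUNT member).  Released under the licence of the surrounding project. -/
import Summits.QuantumFields.BalabanUV.T4Continuum.Support.HistoryRealisePrint
import Summits.QuantumFields.BalabanUV.T4Continuum.Support.HistoryRealisePedigree

/-!
# Print-exactly realised histories are `ConsistentTLE`, pending and `TimedLE`: row S1b's timing displays RE-DERIVED
for `RealisesP` ∕ `PendingBefore` (row S1b-P2 «print-exact carriers», part 1; repair route R-40-a of R-OWNER-40-2)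

Summits-side support leaf of the T⁴-continuum cell (rung (B)+1 on a FINITE torus only; NOT infinite volume, NOT the
mass gap, NOT the Clay statement; NOT a proof of the spine estimate NE7b, which is the cell's OWN estimate, NOT PRINTED
and NOT PROVED).  Row S1b-P2 of `t4/b2b-balaban-t4-ne7b-p1/LEAVES-NE7b.md` (R-OWNER-40-2, `CLAIMS.log` l.26158; claim
l.26451), custodian lineage leaf-08.

WHY.  The owner's located MODEL finding F-ne7bp1g40-1: row S1b's `HistoryRealise.Realises` (this lineage, p209120) asks
the JOIN partners to be pending THROUGH the join scale (`PendingAt … sj`), and the cutoff clause of the carriers asks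
`PendingAt … K` — one index STRONGER than print, which guarantees pendency only STRICTLY BEFORE the scale in question
(B15 p. 177, B16 pp. 384–387: a ready component is integrated or renewed by 𝐑 before the next level's regions exist).
The repair core `HistoryRealisePrint` (owner, p246311) carries the print-exact predicate `RealisesP`, `PendingBefore` and
row S1b's main theorem re-proved for them (`exists_stop_lt_reach_P`, `lt_reach_of_pendingBefore`, `renew_lt_reach_P`,
`adm_of_realisesP`).  THIS FILE re-derives, token for token, the TIMING DISPLAYS the assembly plugs by name —
`HistoryRealiseTimed` §2–§3 (p209488) and `HistoryRealisePedigree` §1–§2 (p209817) — for the print-exact clauses: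
the SAME conclusions (`ConsistentTLE`, `K < reach`, `TimedLE`) from the WEAKER hypotheses.  Append-only: nothing landed
is edited; the landed `Realises` versions stay (and imply these through `realisesP_of_realises`).

WHAT.  §1 **`consistentTLE_toGen_of_realisesP`** (`RealisesP L s R P Z → P.lastStep ≤ K → ConsistentTLE id C K R
P.toGen`; joins inside both partners' booked lives by `lt_reach_of_pendingBefore`), **`consistentTLE_genT_of_realisesP`**,
`consistentTLE_gen_of_realisesP`, **`lt_reach_genT_of_pendingBefore`** (the socket's member field `pending` from STRICT
pendency at the cutoff).  §2 `realisesP_chainJoin_mem`, **`lt_reach_of_chainJoinP`**, **`timedLE_of_realisesP`**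
(`(∀ c, step c ≤ K) → renew_step → (∀ c, ∃ Z, RealisesP L s R (P.toPGen cell c) Z) → TimedLE P K (dictWT Prod.fst R C.n₁)`),
`consistentTLE_genT_of_realisesP'`.  §3 the landed displays as COROLLARIES of the print-exact ones (sanity of the
direction: `Realises → RealisesP`).  Hypotheses as in row S1b: `4 ≤ L`, `∀ m, DropCtl s m`, `∀ t, 1 ≤ R t`, `13 ≤ C.n₁`.
[folklore] junction lemmas; nothing printed asserted, no `def … : Prop`, no `[cite:]`, zero `sorry`.

HONEST.  Junction lemmas on OUR carriers; the reading H3^NE7b, (B) and the BetaPertH-flow facts stay DISPLAYED; by-name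
class of every `WALL-NE7b-P1.md` §2 binder UNCHANGED; the headline of record p224237 stands BY NAME until row S12-P
re-plugs over the print-exact carriers; NE7b NOT proved; spine 0∕9.  HONEST DEPENDENCY (cell): continuum YM on T⁴ ⇐
BetaPertH ∧ nine spine estimates (0/9 proved); BetaPertH ⇐ (D1) ∧ (D4) ∧ CAP+tail; G-an2-4 gates asym, D1 and NE2/3/4.
This file changes none of it. -/

open Finset
open Literature.MathematicalPhysics.QuantumFieldTheory.Balaban1983to89
open Literature.MathematicalPhysics.QuantumFieldTheory.Balaban1983to89.B13ScaleTransfer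
open T4PersistenceDictionary T4TaggedShapeBanking
open Summit.QuantumFields.BalabanUV.T4Continuum.ZoneSkeleton
open Summit.QuantumFields.BalabanUV.T4Continuum.HistoryAdmissible
open Summit.QuantumFields.BalabanUV.T4Continuum.HistoryBankingLE
open Summit.QuantumFields.BalabanUV.T4Continuum.HistoryGen
open Summit.QuantumFields.BalabanUV.T4Continuum.HistoryGenTimedLE
open Summit.QuantumFields.BalabanUV.T4Continuum.HistoryRealise

namespace Summit.QuantumFields.BalabanUV.T4Continuum.HistoryRealisePrint

variable {d : ℕ} {L : ℕ} {s R : ℕ → ℕ}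

/-! ## §1 A print-exactly realised history's labels are `ConsistentTLE`; strict pendency at the cutoff is inside the life -/

section Flat

variable (hL : 4 ≤ L) (hdrop : ∀ m, B16SProfile.DropCtl s m) (hR : ∀ t, 1 ≤ R t)
  (C : T4PrintedShapeBanking.Consts) (hn₁ : 13 ≤ C.n₁)
include hL hdrop hR hn₁

/-- **THE FLAT LABEL OF A PRINT-EXACTLY REALISED HISTORY IS `ConsistentTLE`** (shape map `id`; cutoff `K ≥ lastStep`):
births at their step; renewals dated `h + 1 ≤ booked reach` (`renew_lt_reach_P`) and `≤ K`; joins inside both partners'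
booked lives (`lt_reach_of_pendingBefore` — STRICT pendency at the join scale suffices) after their root steps.  NO timing
hypothesis. [folklore] -/
theorem consistentTLE_toGen_of_realisesP :
    ∀ (P : PGen (Pt d × Finset (Pt d))) (Z : Finset (Pt d)), RealisesP L s R P Z → ∀ {K : ℕ}, P.lastStep ≤ K →
      ConsistentTLE id C K R P.toGen
  | .birth j cls zZ, Z, _, K, hK => ⟨rfl, rfl, hK⟩
  | .renew G h, Z, hP, K, hK => by
      have hlt := renew_lt_reach_P hL hdrop hR hn₁ hP
      obtain ⟨ZG, hG, hready, -, -⟩ := hP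
      have hpos := hready.pos
      simp only [PGen.lastStep] at hK
      refine ⟨consistentTLE_toGen_of_realisesP G ZG hG (K := K) (by omega), rfl, rfl, ?_, hK⟩
      show h + 1 ≤ G.toGen.reach (dictW R C.n₁)
      omega
  | .join X Y sj, Z, hP, K, hK => by
      obtain ⟨ZX, ZY, hX, hY, htX, htY, hpX, hpY, -, -⟩ := hP
      simp only [PGen.lastStep] at hK
      have hrX := lt_reach_of_pendingBefore hL hdrop hR hn₁ hX hpX
      have hrY := lt_reach_of_pendingBefore hL hdrop hR hn₁ hY hpY
      have haX := (adm_of_realisesP X ZX hX htX).rootStep_le_lastStep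
      have haY := (adm_of_realisesP Y ZY hY htY).rootStep_le_lastStep
      refine ⟨consistentTLE_toGen_of_realisesP X ZX hX (htX.trans hK),
        consistentTLE_toGen_of_realisesP Y ZY hY (htY.trans hK), rfl, ?_, ?_, ?_, ?_, hK⟩
      · show X.toGen.rootStep ≤ sj
        rw [PGen.rootStep_toGen]; exact haX.trans htX
      · exact hrX
      · show Y.toGen.rootStep ≤ sj
        rw [PGen.rootStep_toGen]; exact haY.trans htY
      · exact hrY

end Flat

section OnPedigree

variable (hL : 4 ≤ L) (hdrop : ∀ m, B16SProfile.DropCtl s m) (hR : ∀ t, 1 ≤ R t)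
  (C : T4PrintedShapeBanking.Consts) (hn₁ : 13 ≤ C.n₁)
variable {α π : Type*} (P : Pedigree α π) (cell : π → Pt d × Finset (Pt d))
  (hS : ∀ c c', Part.old c' true ∈ P.parts c → P.step c' + 1 = P.step c)
include hL hdrop hR hn₁ hS

/-- **THE TAGGED GENEALOGY OF A PRINT-EXACTLY REALISED COMPONENT IS `ConsistentTLE`** (shape map `Prod.fst`, the
socket's member field `consistent` in its S4c form). [folklore] -/
theorem consistentTLE_genT_of_realisesP {c : α} {Z : Finset (Pt d)} (hc : RealisesP L s R (P.toPGen cell c) Z) {K : ℕ}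
    (hK : (P.toPGen cell c).lastStep ≤ K) : ConsistentTLE Prod.fst C K R (P.genT c) := by
  rw [← consistentTLE_gmap_iff]
  have h := consistentTLE_toGen_of_realisesP hL hdrop hR C hn₁ _ Z hc hK
  rwa [P.toGen_toPGen cell hS c] at h

/-- the same for the FLAT genealogy `P.gen c` (shape map `id`) [folklore] -/
theorem consistentTLE_gen_of_realisesP {c : α} {Z : Finset (Pt d)} (hc : RealisesP L s R (P.toPGen cell c) Z) {K : ℕ}
    (hK : (P.toPGen cell c).lastStep ≤ K) : ConsistentTLE id C K R (P.gen c) := by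
  have h := consistentTLE_toGen_of_realisesP hL hdrop hR C hn₁ _ Z hc hK
  rwa [P.toGen_toPGen cell hS c] at h

/-- **A PRINT-EXACTLY REALISED COMPONENT PENDING STRICTLY BEFORE THE CUTOFF IS INSIDE ITS BOOKED LIFE** (the socket's
member field `pending`, tagged form): `K < (P.genT c).reach (dictWT Prod.fst R C.n₁)` — from `PendingBefore … K`,
the clause print guarantees for a component live at the cutoff. [folklore] -/
theorem lt_reach_genT_of_pendingBefore {c : α} {Z : Finset (Pt d)} (hc : RealisesP L s R (P.toPGen cell c) Z) {K : ℕ}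
    (hK : PendingBefore L s R (P.toPGen cell c).lastStep Z K) : K < (P.genT c).reach (dictWT Prod.fst R C.n₁) := by
  have h := lt_reach_of_pendingBefore hL hdrop hR hn₁ hc hK
  rw [P.toGen_toPGen cell hS c, Pedigree.reach_gen] at h
  exact h

end OnPedigree

/-! ## §2 Chains of joins and `TimedLE`, print-exact -/

/-- **EVERY MEMBER OF A PRINT-EXACTLY REALISED CHAIN IS PRINT-EXACTLY REALISED.** [folklore] -/
theorem realisesP_chainJoin_mem : ∀ (A : PGen (Pt d × Finset (Pt d))) (Bs : List (PGen (Pt d × Finset (Pt d))))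
    (sj : ℕ) (Z : Finset (Pt d)), RealisesP L s R (chainJoin A Bs sj) Z →
      ∀ B ∈ A :: Bs, ∃ ZB, RealisesP L s R B ZB
  | A, [], _, Z, h, B, hB => by
      rw [List.mem_singleton] at hB
      subst hB
      exact ⟨Z, h⟩
  | A, B :: Bs, sj, Z, h, B', hB' => by
      rw [chainJoin] at h
      have ih := realisesP_chainJoin_mem (PGen.join A B sj) Bs sj Z h
      obtain ⟨ZJ, hJ⟩ := ih _ List.mem_cons_self
      obtain ⟨ZX, ZY, hX, hY, -⟩ := hJ
      rcases List.mem_cons.1 hB' with rfl | hB'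
      · exact ⟨ZX, hX⟩
      rcases List.mem_cons.1 hB' with rfl | hB''
      · exact ⟨ZY, hY⟩
      · exact ih B' (List.mem_cons_of_mem _ hB'')

section Main

variable (hL : 4 ≤ L) (hdrop : ∀ m, B16SProfile.DropCtl s m) (hR : ∀ t, 1 ≤ R t) {n₁ : ℕ} (hn₁ : 13 ≤ n₁)
include hL hdrop hR hn₁

/-- **IN A PRINT-EXACTLY REALISED PROPER CHAIN EVERY MEMBER IS INSIDE ITS BOOKED LIFE AT THE JOIN STEP**: the join
clause makes both partners of every node pending STRICTLY BEFORE `sj`, and that is inside the booked life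
(`lt_reach_of_pendingBefore`). [folklore] -/
theorem lt_reach_of_chainJoinP : ∀ (A : PGen (Pt d × Finset (Pt d))) (Bs : List (PGen (Pt d × Finset (Pt d))))
    (sj : ℕ) (Z : Finset (Pt d)), RealisesP L s R (chainJoin A Bs sj) Z → Bs ≠ [] →
      ∀ B ∈ A :: Bs, sj < B.toGen.reach (dictW R n₁)
  | _, [], _, _, _, h, _, _ => absurd rfl h
  | A, B :: Bs, sj, Z, h, _, B', hB' => by
      rw [chainJoin] at h
      obtain ⟨ZJ, hJ⟩ := realisesP_chainJoin_mem (PGen.join A B sj) Bs sj Z h _ List.mem_cons_self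
      obtain ⟨ZX, ZY, hX, hY, -, -, hpX, hpY, -, -⟩ := hJ
      rcases List.mem_cons.1 hB' with rfl | hB'
      · exact lt_reach_of_pendingBefore hL hdrop hR hn₁ hX hpX
      rcases List.mem_cons.1 hB' with rfl | hB''
      · exact lt_reach_of_pendingBefore hL hdrop hR hn₁ hY hpY
      · cases Bs with
        | nil => simp at hB''
        | cons B₂ Bs₂ =>
            exact lt_reach_of_chainJoinP (PGen.join A B sj) (B₂ :: Bs₂) sj Z h (List.cons_ne_nil _ _) B'
              (List.mem_cons_of_mem _ hB'')

end Main

section TimedOnPedigree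

variable {α π : Type*} (P : Pedigree α π) (cell : π → Pt d × Finset (Pt d))
variable (hL : 4 ≤ L) (hdrop : ∀ m, B16SProfile.DropCtl s m) (hR : ∀ t, 1 ≤ R t) (C : T4PrintedShapeBanking.Consts)
  (hn₁ : 13 ≤ C.n₁)
include hL hdrop hR hn₁

/-- **PRINT-EXACTLY REALISED PEDIGREES ARE `TimedLE`.**  If every component of the pedigree is print-exactly realised
through the bridge (`∃ Z, RealisesP L s R (P.toPGen cell c) Z`), every component is observed by the cutoff and renewed
parts come from the previous step, then `TimedLE P K (dictWT Prod.fst R C.n₁)`: `renew_reach` (with `≤`) by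
`renew_lt_reach_P` on the renewal member of the chain, `alive` by `lt_reach_of_chainJoinP`. [folklore] -/
theorem timedLE_of_realisesP {K : ℕ} (hstep : ∀ c, P.step c ≤ K)
    (hS : ∀ c c', Part.old c' true ∈ P.parts c → P.step c' + 1 = P.step c)
    (hreal : ∀ c, ∃ Z, RealisesP L s R (P.toPGen cell c) Z) : TimedLE P K (dictWT Prod.fst R C.n₁) where
  step_le := hstep
  renew_step := hS
  renew_reach c c' hq := by
    obtain ⟨Z, hZ⟩ := hreal c
    obtain ⟨A, As, hch, hmem, -⟩ := toPGen_eq_chainJoin P cell hq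
    rw [hch] at hZ
    obtain ⟨ZE, hE⟩ := realisesP_chainJoin_mem A As (P.step c) Z hZ _ hmem
    have hlt := renew_lt_reach_P hL hdrop hR hn₁ (G := P.toPGen cell c') (h := P.step c') hE
    rw [P.toGen_toPGen cell hS c', Pedigree.reach_gen] at hlt
    have hlt' : P.step c' < (P.genT c').reach (dictWT Prod.fst R C.n₁) := hlt
    have hs := hS c c' hq
    show P.step c ≤ (P.genT c').reach (dictWT Prod.fst R C.n₁)
    omega
  alive c c' hq h2 := by
    obtain ⟨Z, hZ⟩ := hreal c
    obtain ⟨A, As, hch, hmem, hne⟩ := toPGen_eq_chainJoin P cell hq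
    rw [hch] at hZ
    have hlt := lt_reach_of_chainJoinP hL hdrop hR hn₁ A As (P.step c) Z hZ (hne h2) _ hmem
    rw [show P.partPGen cell c (P.toPGen cell) (Part.old c' false) = P.toPGen cell c' from rfl,
      P.toGen_toPGen cell hS c', Pedigree.reach_gen] at hlt
    exact hlt

/-- hence the tagged genealogies of all components are `ConsistentTLE` by leaf-02's route as well [folklore] -/
theorem consistentTLE_genT_of_realisesP' {K : ℕ} (hstep : ∀ c, P.step c ≤ K)
    (hS : ∀ c c', Part.old c' true ∈ P.parts c → P.step c' + 1 = P.step c)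
    (hreal : ∀ c, ∃ Z, RealisesP L s R (P.toPGen cell c) Z) (c : α) : ConsistentTLE Prod.fst C K R (P.genT c) :=
  consistentTLE_genT (timedLE_of_realisesP P cell hL hdrop hR C hn₁ hstep hS hreal) c

end TimedOnPedigree

/-! ## §3 Sanity of the direction: the landed displays are corollaries of the print-exact ones -/

section Corollaries

variable (hL : 4 ≤ L) (hdrop : ∀ m, B16SProfile.DropCtl s m) (hR : ∀ t, 1 ≤ R t)
  (C : T4PrintedShapeBanking.Consts) (hn₁ : 13 ≤ C.n₁)
include hL hdrop hR hn₁

/-- row S1b's `consistentTLE_toGen_of_realises` RECOVERED from the print-exact form through `realisesP_of_realises`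
(the two routes agree on the landed hypotheses) [folklore] -/
example {P : PGen (Pt d × Finset (Pt d))} {Z : Finset (Pt d)} (hP : Realises L s R P Z) {K : ℕ} (hK : P.lastStep ≤ K) :
    ConsistentTLE id C K R P.toGen :=
  consistentTLE_toGen_of_realisesP hL hdrop hR C hn₁ P Z (realisesP_of_realises P Z hP) hK

/-- row S1b's `lt_reach_of_pendingAt` RECOVERED: through-the-scale pendency is the stronger clause [folklore] -/
example {P : PGen (Pt d × Finset (Pt d))} {Z : Finset (Pt d)} (hP : Realises L s R P Z) {K : ℕ}
    (hK : PendingAt L s R P.lastStep Z K) : K < P.toGen.reach (dictW R C.n₁) :=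
  lt_reach_of_pendingBefore hL hdrop hR hn₁ (realisesP_of_realises P Z hP) (pendingBefore_of_pendingAt hK)

end Corollaries

end Summit.QuantumFields.BalabanUV.T4Continuum.HistoryRealisePrint
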